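import Summits.NavierStokesRegularity.NavierStokesRegularity.Theses.RellichScar
import Summits.NavierStokesRegularity.NavierStokesRegularity.Theorems.RellichScarSymmetricScarExistsApexClassicalRepresentative
import Summits.NavierStokesRegularity.NavierStokesRegularity.Theorems.RellichScarSymmetricScarExistsApexLerayProfile
import Literature.Analysis.FluidPDE.PineauVicolRSSAlphaZero
import Literature.Analysis.FluidPDE.AncientLimitVanishingScaled
import Literature.Analysis.FluidPDE.LocalTypeILiouville
import Literature.Analysis.FluidPDE.ClassicalSolutionCalculus

/-!
# Route RellichScar, support `SelfSimilarApexFatal` (stmt-NavierStokesRegularity-11721):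
# an apex Type-I profile singular at the origin is not a.e. self-similar

Closes the route decl
`Summit.NavierStokesRegularity.NavierStokesRegularity.Theses.RellichScar.SelfSimilarApexFatal`:
a suitable weak solution `(u, p)` of Navier–Stokes (`ν = 1`, `f = 0`) on the slab `(−∞,0) × ℝ³` with
a weak spatial gradient `G`, Albritton–Barker quantity `𝐈(ℝ³ × ℝ₋) < ∞`, the space–time Type-I bound
`‖u(t,x)‖ ≤ C/(‖x‖ + √(−t))` and a backward-singular origin cannot satisfy
`λ u(λ²t, λx) = u(t,x)` a.e. on the slab for every `λ > 0`.

Proof (representative bookkeeping + Tsai 1998):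

1. `stub_apexClassicalRepresentative` (sibling crux `SymmetricScarExists`, KNSS 2009 Lemma 3.1 +
   Prop. 4.1): `u` agrees a.e. on the slab with a CLASSICAL solution `(v, q)` on `(−∞, 0)`; the
   continuous `v` inherits the Type-I bound (`hasTypeIDecay_of_ae_eq`).
2. The parabolic dilation `(t,x) ↦ (λ²t, λx)` is quasi-measure-preserving and maps the slab into
   itself, so the a.e. self-similarity transfers from `u` to `v` (`ae_selfSimilar_of_ae_eq`); both
   sides being continuous on the open slab, `v` is EXACTLY self-similar there
   (`Measure.eqOn_open_of_ae_eq`), hence `v(t,x) = (−t)^{-1/2} U(x/√(−t))` with `U = v(−1, ·)`,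
   i.e. `v = lerayBackward ½ 0 U` on `t < 0`.
3. `pineauVicol2026_rss_liouville_alpha_zero` (the tree's packaging of Tsai 1998, Thm 1, for Type-I
   self-similar classical solutions: Leray's reduction makes `(U, Q)` a profile, the Type-I bound puts
   `U` in `L⁴`, and `tsai_selfsimilar_holds` kills it) gives `U = 0`.
4. Hence `v = 0` on the slab, `u = 0` a.e. on the slab ⊇ `Q((0,0),1)`, so
   `‖u‖_{L^∞(Q((0,0),1))} = 0 ≠ ∞`, contradicting `IsBackwardSingularPoint u 0`.

(The route's informal sketch feeds Tsai's Theorem 2 — local energy estimates from `𝐈 < ∞` — instead;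
Theorem 1 via the Type-I bound is the shorter path in the tree. `G` and `𝐈 < ∞` enter only through the
classical representative.)

## References

* T.-P. Tsai, Arch. Rational Mech. Anal. 143 (1998) 29–51, Theorem 1. [Tsai1998]
* J. Nečas, M. Růžička, V. Šverák, Acta Math. 176 (1996) 283–294, Theorem 1. [NecasRuzickaSverak1996]
* G. Koch, N. Nadirashvili, G. Seregin, V. Šverák, Acta Math. 203 (2009) = arXiv:0709.3599,
  Lemma 3.1, Prop. 4.1. [KochNadirashviliSereginSverak2009]
* B. Pineau, V. Vicol, arXiv:2607.09619 (2026), Theorem 1.4 at `α = 0`. [PineauVicol2026]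
-/

noncomputable section

open MeasureTheory Set Function Filter Topology

namespace Summit.NavierStokesRegularity.NavierStokesRegularity.Theorems

open Literature.Analysis.FluidPDE
open Summit.NavierStokesRegularity.NavierStokesRegularity.Theorems.SymmetricScarExists.LogtimeBernoulli
  (stub_apexClassicalRepresentative hasTypeIDecay_of_ae_eq)

/-- **A.e. self-similarity passes to an a.e.-equal field.** If `v = u` a.e. on the slab
`(−∞,0) × ℝ³` and `λ u(λ²t, λx) = u(t,x)` a.e. on the slab (`λ > 0`), then
`λ v(λ²t, λx) = v(t,x)` a.e. on the slab: the parabolic dilation `(t,x) ↦ (λ²t, λx)` is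
quasi-measure-preserving (`quasiMeasurePreserving_parabolicDilation`) and maps the slab into itself.
[folklore] -/
theorem ae_selfSimilar_of_ae_eq
    {u v : ℝ → EuclideanSpace ℝ (Fin 3) → EuclideanSpace ℝ (Fin 3)}
    (hae : uncurry v =ᵐ[volume.restrict (Iio (0 : ℝ) ×ˢ (univ : Set (EuclideanSpace ℝ (Fin 3))))]
      uncurry u)
    {lam : ℝ} (hlam : 0 < lam)
    (hss : uncurry (nsRescale lam u)
      =ᵐ[volume.restrict (Iio (0 : ℝ) ×ˢ (univ : Set (EuclideanSpace ℝ (Fin 3))))] uncurry u) :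
    uncurry (nsRescale lam v)
      =ᵐ[volume.restrict (Iio (0 : ℝ) ×ˢ (univ : Set (EuclideanSpace ℝ (Fin 3))))] uncurry v := by
  have hS : MeasurableSet (Iio (0 : ℝ) ×ˢ (univ : Set (EuclideanSpace ℝ (Fin 3)))) :=
    measurableSet_Iio.prod MeasurableSet.univ
  have hq := quasiMeasurePreserving_parabolicDilation hlam.ne'
  have hae' : ∀ᵐ z : ℝ × EuclideanSpace ℝ (Fin 3) ∂volume,
      z ∈ Iio (0 : ℝ) ×ˢ (univ : Set (EuclideanSpace ℝ (Fin 3))) → uncurry v z = uncurry u z :=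
    (ae_restrict_iff' hS).1 hae
  -- pull `v = u` back along the dilation, which maps the slab into itself
  have h1 : ∀ᵐ z : ℝ × EuclideanSpace ℝ (Fin 3)
      ∂(volume.restrict (Iio (0 : ℝ) ×ˢ (univ : Set (EuclideanSpace ℝ (Fin 3))))),
      uncurry v (lam ^ 2 * z.1, lam • z.2) = uncurry u (lam ^ 2 * z.1, lam • z.2) := by
    refine (ae_restrict_iff' hS).2 ?_
    filter_upwards [hq.ae hae'] with z hz hzS
    exact hz ⟨show lam ^ 2 * z.1 < 0 from mul_neg_of_pos_of_neg (pow_pos hlam 2) hzS.1, mem_univ _⟩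
  filter_upwards [h1, hss, hae] with ⟨t, x⟩ hz hzs hza
  simp only [uncurry_apply_pair, nsRescale_apply] at hz hzs hza ⊢
  rw [hz, hzs, hza]

/-- **`SelfSimilarApexFatal` (route RellichScar, stmt-NavierStokesRegularity-11721).** An apex Type-I
profile singular at the origin — `(u, p)` suitable weak on the slab `(−∞,0) × ℝ³` (`ν = 1`, `f = 0`),
weak spatial gradient `G`, `𝐈(ℝ³ × ℝ₋) < ∞`, `‖u(t,x)‖ ≤ C/(‖x‖ + √(−t))`,
`IsBackwardSingularPoint u 0` — cannot be a.e. self-similar under every `λ > 0`.  The classical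
representative `v` of `u` (KNSS 2009 via `stub_apexClassicalRepresentative`) is exactly self-similar on
the open slab (a.e. self-similarity transported by the quasi-measure-preserving parabolic dilation,
then continuity), hence `v = lerayBackward ½ 0 (v(−1))` there; Tsai 1998, Theorem 1 in the tree's
Type-I packaging `pineauVicol2026_rss_liouville_alpha_zero` gives `v(−1) = 0`, so `u = 0` a.e. on the
slab and `‖u‖_{L^∞(Q((0,0),1))} = 0 ≠ ∞`. [cite: Tsai1998, Theorem 1; KochNadirashviliSereginSverak2009, Lemma 3.1 and Prop. 4.1 (arXiv:0709.3599 pp. 7–8)] -/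
theorem rellichScar_selfSimilarApexFatal_proof :
    Summit.NavierStokesRegularity.NavierStokesRegularity.Theses.RellichScar.SelfSimilarApexFatal := by
  intro u p G C hsw hwg hI hdec hsing hss
  -- Step 1: classical representative `(v, q)` on `(−∞, 0)`, inheriting the Type-I bound
  obtain ⟨v, q, hcl, hae⟩ := stub_apexClassicalRepresentative u p G C hsw hwg hI hdec
  have hdecv : HasTypeIDecay C v := hasTypeIDecay_of_ae_eq hcl hae hdec
  have hSo : IsOpen (Iio (0 : ℝ) ×ˢ (univ : Set (EuclideanSpace ℝ (Fin 3)))) :=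
    isOpen_Iio.prod isOpen_univ
  have hSm : MeasurableSet (Iio (0 : ℝ) ×ˢ (univ : Set (EuclideanSpace ℝ (Fin 3)))) :=
    measurableSet_Iio.prod MeasurableSet.univ
  have hvcont : ContinuousOn (uncurry v) (Iio (0 : ℝ) ×ˢ (univ : Set (EuclideanSpace ℝ (Fin 3)))) :=
    hcl.smooth_velocity.continuousOn
  -- Step 2: `v` is exactly self-similar on the open slab
  have hssv : ∀ lam : ℝ, 0 < lam → ∀ t < (0 : ℝ), ∀ x : EuclideanSpace ℝ (Fin 3),
      lam • v (lam ^ 2 * t) (lam • x) = v t x := by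
    intro lam hlam t ht x
    have h1 := ae_selfSimilar_of_ae_eq hae hlam (hss lam hlam)
    have hcont' : ContinuousOn (uncurry (nsRescale lam v))
        (Iio (0 : ℝ) ×ˢ (univ : Set (EuclideanSpace ℝ (Fin 3)))) := by
      have hΦ : Continuous fun z : ℝ × EuclideanSpace ℝ (Fin 3) =>
          ((lam ^ 2 * z.1, lam • z.2) : ℝ × EuclideanSpace ℝ (Fin 3)) := by fun_prop
      have hmaps : MapsTo (fun z : ℝ × EuclideanSpace ℝ (Fin 3) =>
            ((lam ^ 2 * z.1, lam • z.2) : ℝ × EuclideanSpace ℝ (Fin 3)))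
          (Iio (0 : ℝ) ×ˢ (univ : Set (EuclideanSpace ℝ (Fin 3))))
          (Iio (0 : ℝ) ×ˢ (univ : Set (EuclideanSpace ℝ (Fin 3)))) := fun z hz =>
        ⟨show lam ^ 2 * z.1 < 0 from mul_neg_of_pos_of_neg (pow_pos hlam 2) hz.1, mem_univ _⟩
      have h2 := (hvcont.comp hΦ.continuousOn hmaps).const_smul lam
      refine h2.congr ?_
      rintro ⟨s, y⟩ -
      simp [nsRescale_apply]
    have key := Measure.eqOn_open_of_ae_eq h1 hSo hcont' hvcont
      (show ((t, x) : ℝ × EuclideanSpace ℝ (Fin 3)) ∈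
        Iio (0 : ℝ) ×ˢ (univ : Set (EuclideanSpace ℝ (Fin 3))) from ⟨ht, mem_univ _⟩)
    simpa [nsRescale_apply] using key
  -- Step 3: `v` is Leray's backward self-similar field of its slice `v (-1)`
  have hler : ∀ t < (0 : ℝ), ∀ x : EuclideanSpace ℝ (Fin 3),
      v t x = lerayBackward (1 / 2) 0 (v (-1)) t x := by
    intro t ht x
    have hnt : 0 < -t := neg_pos.2 ht
    have hl : 0 < (Real.sqrt (-t))⁻¹ := inv_pos.2 (Real.sqrt_pos.2 hnt)
    have key := hssv _ hl t ht x
    have hsq : ((Real.sqrt (-t))⁻¹) ^ 2 * t = -1 := by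
      rw [inv_pow, Real.sq_sqrt hnt.le, inv_mul_eq_div, div_neg, div_self ht.ne]
    rw [hsq] at key
    have h2 : Real.sqrt (2 * (1 / 2) * (0 - t)) = Real.sqrt (-t) := by
      congr 1
      ring
    rw [lerayBackward_apply, h2]
    exact key.symm
  -- Step 4: Tsai's theorem (Type-I self-similar classical solutions vanish): `v (-1) = 0`
  have hU0 : v (-1) = 0 := by
    refine pineauVicol2026_rss_liouville_alpha_zero C v q (v (-1))
      (hcl.mono Ico_subset_Iio_self (uniqueDiffOn_Ico (-1) 0)) (fun t ht x => hdecv t ht.2 x) ?_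
    intro t ht x
    rw [pvAnsatz_zero_eq_lerayBackward]
    exact hler t ht.2 x
  -- Step 5: hence `v = 0` on the slab and `u = 0` a.e. on the slab
  have hv0 : ∀ t < (0 : ℝ), ∀ x : EuclideanSpace ℝ (Fin 3), v t x = 0 := by
    intro t ht x
    rw [hler t ht x, hU0]
    simp [lerayBackward_apply]
  have hu0 : uncurry u =ᵐ[volume.restrict (Iio (0 : ℝ) ×ˢ (univ : Set (EuclideanSpace ℝ (Fin 3))))]
      (0 : ℝ × EuclideanSpace ℝ (Fin 3) → EuclideanSpace ℝ (Fin 3)) := by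
    filter_upwards [hae, ae_restrict_mem hSm] with z hz hzS
    rw [← hz]
    exact hv0 z.1 hzS.1 z.2
  -- Step 6: the origin is then not a backward singular point
  have hsub : parabolicCylinder 1 (0 : ℝ × EuclideanSpace ℝ (Fin 3)) ⊆
      Iio (0 : ℝ) ×ˢ (univ : Set (EuclideanSpace ℝ (Fin 3))) :=
    parabolicCylinder_origin_subset_slab 1
  have hu0' : uncurry u =ᵐ[volume.restrict (parabolicCylinder 1 (0 : ℝ × EuclideanSpace ℝ (Fin 3)))]
      (0 : ℝ × EuclideanSpace ℝ (Fin 3) → EuclideanSpace ℝ (Fin 3)) :=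
    ae_restrict_of_ae_restrict_of_subset hsub hu0
  have h0 : eLpNorm (uncurry u) ⊤
      (volume.restrict (parabolicCylinder 1 (0 : ℝ × EuclideanSpace ℝ (Fin 3)))) = 0 := by
    rw [eLpNorm_congr_ae hu0', eLpNorm_zero]
  exact ENNReal.zero_ne_top (h0.symm.trans (hsing 1 one_pos))

end Summit.NavierStokesRegularity.NavierStokesRegularity.Theorems

end
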